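import Summits.QuantumFields.YangMills.Theorems.LuscherReductionTwistedTraceScalingBOProjection
import Summits.QuantumFields.YangMills.Theorems.LuscherReductionTwistedTraceScalingColourAverageChart
import Summits.QuantumFields.YangMills.Theorems.LuscherReductionTwistedTraceScalingOrthoTransverseRotation
import HarnessLib

/-!
# Preliminaries for the Born–Oppenheimer ASSEMBLY: colour average of BO functions, their weighted norm, the bilinear tube form, supports
# (lane A of S-BASE, crux `TwistedTraceScaling` stmt-QuantumFields-20203, C4 INNER; design note `pub/ym-fleet/ym-luscher-20007-p1/COARSE-DESIGN.md` §24.4 (G))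

Structural facts about the BO functions `boFun φ Ω` (`…BOProjection`) used by the assembly `SoftTubeBOPackageOn ⟸ bricks`:
* `conj_mem_orthoTubeSet_iff`, ★ `colourAvg_boFun` — `colourAvg (boFun φ Ω) = boFun (colourAvg φ) Ω` for colour-blind `Ω` (the R32 step inside SLOW);
* ★ `tubeNormSq_boFun` — `‖boFun φ Ω‖²_w = ∫ φ(u)²·fibreMass w Ω u du` (exact);
* `tubeCross` (the bilinear tube form) and ★ `tubeForm_add` — `T(u+v) = T(u) + X(u,v) + X(v,u) + T(v)`;
* `boFun_ne_zero` (support of a BO function), `fibreInner_eq_zero_of_vanish` (fibre pairings over slow points where the function vanishes on the fibre);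
* `ae_eq_zero_of_integral_sq_eq_zero`, ★ `qform_eq_zero_of_integral_sq_eq_zero` — a bounded measurable one-site function with `‖φ‖² = 0` has zero transfer form (no physicality needed).
HONEST FRAMING: bookkeeping for a stub of a child of the CONDITIONAL reduction route R2b1; no spectral claim; C4 OPEN; not a gap, not Clay.
-/

set_option autoImplicit false

noncomputable section

open MeasureTheory Filter Topology Real
open scoped BigOperators
open Literature.MathematicalPhysics.QuantumFieldTheory
open Literature.MathematicalPhysics.QuantumLattice

namespace Summit.QuantumFields.YangMills.Theorems.FemtoTransferGap.TwoLattice.ConstTube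

open Summit.QuantumFields.YangMills.Theorems.FemtoTransferGap
open Summit.QuantumFields.YangMills.Theorems.FemtoTransferGap.TwoLattice.Avg
open Summit.QuantumFields.YangMills.Theorems.FemtoTransferGap.TwoLattice.Stiff (LinkSpace)

variable (L : ℕ) [NeZero L]

/-! ## §1 The colour average of a BO function -/

/-- The orthographic tube is invariant under global colour rotations. [folklore] -/
theorem conj_mem_orthoTubeSet_iff (g : SU2) (U : GaugeConfig 3 L SU2) : gaugeTransform (fun _ : Site 3 L => g) U ∈ orthoTubeSet L ↔ U ∈ orthoTubeSet L := by
  have key : ∀ (h : SU2) (V : GaugeConfig 3 L SU2), V ∈ orthoTubeSet L → gaugeTransform (fun _ : Site 3 L => h) V ∈ orthoTubeSet L := by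
    rintro h V ⟨u, v, hv, rfl⟩
    refine ⟨gaugeTransform (fun _ : Site 3 1 => h) u, colourRotate L (fun _ => h) v, colourRotate_mem_capBalancedSet L hv, ?_⟩
    funext e
    rw [gaugeTransform_const_apply', orthoTube_apply, orthoTube_apply, gaugeTransform_const_apply']
    simp only [colourRotate]
    rw [chartSU2_adRot h (sum_sq_le_one_of_cap L hv.2 e)]
    group
  constructor
  · intro h
    have h2 := key g⁻¹ _ h
    rwa [gaugeTransform_const_const, inv_mul_cancel, show (fun _ : Site 3 L => (1 : SU2)) = 1 from rfl, TT.gaugeTransform_one'] at h2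
  · exact key g U

/-- ★ **Colour average of a BO function**: `colourAvg (boFun φ Ω) = boFun (colourAvg φ) Ω` for colour-blind `Ω` (the right-hand `colourAvg` is the one-site one).
[folklore] -/
theorem colourAvg_boFun (φ : GaugeConfig 3 1 SU2 → ℝ) {Ω : LinkSpace L → ℝ} (hΩ : ∀ (g : SU2) (v : LinkSpace L), Ω (adL L g v) = Ω v) (U : GaugeConfig 3 L SU2) :
    colourAvg (boFun L φ Ω) U = boFun L (colourAvg (L := 1) φ) Ω U := by
  unfold boFun
  by_cases hU : U ∈ orthoTubeSet L
  · rw [Set.indicator_of_mem hU, one_mul, ← colourAvg_slowProduct L φ hΩ U]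
    unfold colourAvg
    refine integral_congr_ae (ae_of_all _ fun g => ?_)
    dsimp only
    rw [Set.indicator_of_mem ((conj_mem_orthoTubeSet_iff L g U).mpr hU), one_mul]
  · rw [Set.indicator_of_notMem hU, zero_mul]
    unfold colourAvg
    have h : ∀ g : SU2, (orthoTubeSet L).indicator (fun _ => (1 : ℝ)) (gaugeTransform (fun _ : Site 3 L => g) U) *
        (φ (slowMean L (gaugeTransform (fun _ : Site 3 L => g) U)) * Ω (relLinkVec L (gaugeTransform (fun _ : Site 3 L => g) U))) = 0 := fun g => by
      rw [Set.indicator_of_notMem (fun h => hU ((conj_mem_orthoTubeSet_iff L g U).mp h)), zero_mul]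
    simp [h]

/-! ## §2 The weighted norm of a BO function -/

variable {L}

/-- ★ **`‖boFun φ Ω‖²_w = ∫ φ(u)²·fibreMass w Ω u du`** (bounded measurable data). [folklore] -/
theorem tubeNormSq_boFun {φ : GaugeConfig 3 1 SU2 → ℝ} (hφ : Measurable φ) {Cφ : ℝ} (hCφ : ∀ u, |φ u| ≤ Cφ) {Ω : LinkSpace L → ℝ} (hΩ : Measurable Ω) {CΩ : ℝ}
    (hCΩ : ∀ x, |Ω x| ≤ CΩ) {w : GaugeConfig 3 L SU2 → ℝ} (hw : Measurable w) {Cw : ℝ} (hCw : ∀ U, |w U| ≤ Cw) :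
    tubeNormSq w (boFun L φ Ω) = ∫ u, φ u ^ 2 * fibreMass L w Ω u ∂configMeasure SU2 1 := by
  unfold tubeNormSq
  have e : (fun U => boFun L φ Ω U ^ 2 * w U) = fun U => boFun L φ Ω U * boFun L φ Ω U * w U := by funext U; ring
  rw [e, integral_boFun_mul_eq hφ hCφ hΩ hCΩ (measurable_boFun L hφ hΩ) (abs_boFun_le L hCφ hCΩ) hw hCw]
  refine integral_congr_ae (ae_of_all _ fun u => ?_)
  dsimp only
  rw [fibreInner_boFun]; ring

/-! ## §3 The bilinear tube form -/

/-- The bilinear tube form `X(f,g) = ∫∫ f(U) K̃_β(U,V) g(V)`. [cite: SeilerLNP1982, §3] -/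
def tubeCross (β : ℝ) (f g : GaugeConfig 3 L SU2 → ℝ) : ℝ :=
  ∫ U, ∫ V, f U * avgKernel β U V * g V ∂configMeasure SU2 L ∂configMeasure SU2 L

/-- `X(f,f) = T(f)`. [folklore] -/
theorem tubeCross_self (β : ℝ) (f : GaugeConfig 3 L SU2 → ℝ) : tubeCross β f f = tubeForm β f := rfl

/-- The inner `V`-integral `∫ K̃(U,V) g(V) dV` is integrable in nothing — it is a bounded measurable function of `U`; packaged integrability of `U ↦ f(U)·∫K̃(U,V)g(V)dV`. [folklore] -/
theorem integrable_mul_integral_avgKernel (β : ℝ) {f g : GaugeConfig 3 L SU2 → ℝ} (hf : Measurable f) {Cf : ℝ} (hCf : ∀ U, |f U| ≤ Cf) (hg : Measurable g) {Cg : ℝ}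
    (hCg : ∀ U, |g U| ≤ Cg) : Integrable (fun U => f U * ∫ V, avgKernel β U V * g V ∂configMeasure SU2 L) (configMeasure SU2 L) := by
  obtain ⟨hJm, ⟨MJ, hJb⟩, -⟩ := integral_avgKernel_mul_props β hg hCg
  have hCf0 : 0 ≤ Cf := (abs_nonneg _).trans (hCf 1)
  exact integrable_of_measurable_abs_le _ (hf.mul hJm) (C := Cf * MJ) fun U => by
    rw [abs_mul]; exact mul_le_mul (hCf U) (hJb U) (abs_nonneg _) hCf0

/-- The row form of `X`: `X(f,g) = ∫ f(U)·(∫ K̃(U,V) g(V) dV) dU`. [folklore] -/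
theorem tubeCross_eq_integral_mul (β : ℝ) (f g : GaugeConfig 3 L SU2 → ℝ) :
    tubeCross β f g = ∫ U, f U * (∫ V, avgKernel β U V * g V ∂configMeasure SU2 L) ∂configMeasure SU2 L := by
  unfold tubeCross
  refine integral_congr_ae (ae_of_all _ fun U => ?_)
  dsimp only
  rw [← integral_const_mul]
  refine integral_congr_ae (ae_of_all _ fun V => ?_)
  dsimp only; ring

/-- The inner integral is additive in `g`. [folklore] -/
theorem integral_avgKernel_mul_add (β : ℝ) {g h : GaugeConfig 3 L SU2 → ℝ} (hg : Measurable g) {Cg : ℝ} (hCg : ∀ U, |g U| ≤ Cg) (hh : Measurable h) {Ch : ℝ}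
    (hCh : ∀ U, |h U| ≤ Ch) (U : GaugeConfig 3 L SU2) :
    ∫ V, avgKernel β U V * (g V + h V) ∂configMeasure SU2 L = (∫ V, avgKernel β U V * g V ∂configMeasure SU2 L) + ∫ V, avgKernel β U V * h V ∂configMeasure SU2 L := by
  obtain ⟨M, hM0, hM⟩ := exists_avgKernel_le (L := L) β
  have hK : ∀ V, |avgKernel β U V| ≤ M := fun V => by rw [abs_of_pos (avgKernel_pos β U V)]; exact hM U V
  have hig : Integrable (fun V => avgKernel β U V * g V) (configMeasure SU2 L) :=
    integrable_of_measurable_abs_le _ ((measurable_avgKernel_right β U).mul hg) (C := M * Cg) fun V => by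
      rw [abs_mul]; exact mul_le_mul (hK V) (hCg V) (abs_nonneg _) hM0.le
  have hih : Integrable (fun V => avgKernel β U V * h V) (configMeasure SU2 L) :=
    integrable_of_measurable_abs_le _ ((measurable_avgKernel_right β U).mul hh) (C := M * Ch) fun V => by
      rw [abs_mul]; exact mul_le_mul (hK V) (hCh V) (abs_nonneg _) hM0.le
  rw [← integral_add hig hih]
  refine integral_congr_ae (ae_of_all _ fun V => ?_)
  dsimp only; ring

/-- ★ **`T(u + v) = T(u) + X(u,v) + X(v,u) + T(v)`** for bounded measurable `u, v`. [folklore] -/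
theorem tubeForm_add (β : ℝ) {u v : GaugeConfig 3 L SU2 → ℝ} (hu : Measurable u) {Cu : ℝ} (hCu : ∀ U, |u U| ≤ Cu) (hv : Measurable v) {Cv : ℝ} (hCv : ∀ U, |v U| ≤ Cv) :
    tubeForm β (fun U => u U + v U) = tubeForm β u + tubeCross β u v + tubeCross β v u + tubeForm β v := by
  rw [← tubeCross_self, ← tubeCross_self, ← tubeCross_self, tubeCross_eq_integral_mul, tubeCross_eq_integral_mul, tubeCross_eq_integral_mul,
    tubeCross_eq_integral_mul, tubeCross_eq_integral_mul]
  have h1 := integrable_mul_integral_avgKernel β hu hCu hu hCu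
  have h2 := integrable_mul_integral_avgKernel β hu hCu hv hCv
  have h3 := integrable_mul_integral_avgKernel β hv hCv hu hCu
  have h4 := integrable_mul_integral_avgKernel β hv hCv hv hCv
  have hsum : Integrable (fun U => (u U * ∫ V, avgKernel β U V * u V ∂configMeasure SU2 L) + (u U * ∫ V, avgKernel β U V * v V ∂configMeasure SU2 L) +
      (v U * ∫ V, avgKernel β U V * u V ∂configMeasure SU2 L) + (v U * ∫ V, avgKernel β U V * v V ∂configMeasure SU2 L)) (configMeasure SU2 L) :=
    ((h1.add h2).add h3).add h4
  have hpt : ∀ U, (u U + v U) * ∫ V, avgKernel β U V * (u V + v V) ∂configMeasure SU2 L =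
      (u U * ∫ V, avgKernel β U V * u V ∂configMeasure SU2 L) + (u U * ∫ V, avgKernel β U V * v V ∂configMeasure SU2 L) +
      (v U * ∫ V, avgKernel β U V * u V ∂configMeasure SU2 L) + (v U * ∫ V, avgKernel β U V * v V ∂configMeasure SU2 L) := fun U => by
    rw [integral_avgKernel_mul_add β hu hCu hv hCv U]; ring
  calc ∫ U, (u U + v U) * ∫ V, avgKernel β U V * (u V + v V) ∂configMeasure SU2 L ∂configMeasure SU2 L
      = ∫ U, ((u U * ∫ V, avgKernel β U V * u V ∂configMeasure SU2 L) + (u U * ∫ V, avgKernel β U V * v V ∂configMeasure SU2 L) +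
          (v U * ∫ V, avgKernel β U V * u V ∂configMeasure SU2 L) + (v U * ∫ V, avgKernel β U V * v V ∂configMeasure SU2 L)) ∂configMeasure SU2 L :=
        integral_congr_ae (ae_of_all _ hpt)
    _ = _ := by
        have h12 : Integrable (fun U => (u U * ∫ V, avgKernel β U V * u V ∂configMeasure SU2 L) + (u U * ∫ V, avgKernel β U V * v V ∂configMeasure SU2 L))
            (configMeasure SU2 L) := h1.add h2
        have h123 : Integrable (fun U => (u U * ∫ V, avgKernel β U V * u V ∂configMeasure SU2 L) + (u U * ∫ V, avgKernel β U V * v V ∂configMeasure SU2 L) +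
            (v U * ∫ V, avgKernel β U V * u V ∂configMeasure SU2 L)) (configMeasure SU2 L) := h12.add h3
        rw [integral_add h123 h4, integral_add h12 h3, integral_add h1 h2]

/-! ## §4 Supports -/

variable (L) in
/-- A BO function is supported on the tube, where its slow amplitude and fibre profile are nonzero. [folklore] -/
theorem boFun_ne_zero {φ : GaugeConfig 3 1 SU2 → ℝ} {Ω : LinkSpace L → ℝ} {U : GaugeConfig 3 L SU2} (h : boFun L φ Ω U ≠ 0) :
    U ∈ orthoTubeSet L ∧ φ (slowMean L U) ≠ 0 ∧ Ω (relLinkVec L U) ≠ 0 := by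
  unfold boFun at h
  by_cases hU : U ∈ orthoTubeSet L
  · rw [Set.indicator_of_mem hU, one_mul] at h
    exact ⟨hU, left_ne_zero_of_mul h, right_ne_zero_of_mul h⟩
  · rw [Set.indicator_of_notMem hU, zero_mul] at h
    exact absurd rfl h

/-- Fibre pairings vanish over slow points on whose fibre the function vanishes (the transverse measure is carried by the cap). [folklore] -/
theorem fibreInner_eq_zero_of_vanish {w : GaugeConfig 3 L SU2 → ℝ} {Ω : LinkSpace L → ℝ} {g : GaugeConfig 3 L SU2 → ℝ} {u : GaugeConfig 3 1 SU2}
    (hg : ∀ v ∈ capBalancedSet L, g (orthoTube L u v) = 0) : fibreInner L w Ω g u = 0 := by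
  unfold fibreInner
  have hae : ∀ᵐ v ∂orthoTransverse L, v ∈ capBalancedSet L := by rw [ae_iff]; exact orthoTransverse_compl_capBalancedSet L
  refine integral_eq_zero_of_ae (hae.mono fun v hv => ?_)
  show g (orthoTube L u v) * Ω (linkEmbed L v) * w (orthoTube L u v) = (0 : (Edge 3 L → Fin 3 → ℝ) → ℝ) v
  rw [hg v hv, zero_mul, zero_mul]; rfl

/-! ## §5 One-site functions of zero norm have zero transfer form (bounded measurable, no physicality) -/

/-- A bounded measurable function with `∫ φ² = 0` vanishes almost everywhere. [folklore] -/
theorem ae_eq_zero_of_integral_sq_eq_zero {M : ℕ} [NeZero M] {φ : GaugeConfig 3 M SU2 → ℝ} (hφ : Measurable φ) {C : ℝ} (hC : ∀ U, |φ U| ≤ C)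
    (h0 : ∫ U, φ U ^ 2 ∂configMeasure SU2 M = 0) : φ =ᵐ[configMeasure SU2 M] 0 := by
  have hint : Integrable (fun U => φ U ^ 2) (configMeasure SU2 M) :=
    integrable_of_measurable_abs_le _ (hφ.pow_const 2) (C := C ^ 2) fun U => by rw [abs_pow]; exact pow_le_pow_left₀ (abs_nonneg _) (hC U) 2
  have h := (integral_eq_zero_iff_of_nonneg (fun U => sq_nonneg (φ U)) hint).mp h0
  filter_upwards [h] with U hU
  simpa using hU

/-- ★ **Zero norm ⇒ zero transfer form** for bounded measurable one-site (indeed any-volume) functions. [folklore] -/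
theorem qform_eq_zero_of_integral_sq_eq_zero {M : ℕ} [NeZero M] (β : ℝ) {φ : GaugeConfig 3 M SU2 → ℝ} (hφ : Measurable φ) {C : ℝ} (hC : ∀ U, |φ U| ≤ C)
    (h0 : ∫ U, φ U ^ 2 ∂configMeasure SU2 M = 0) : qform su2Rep β φ φ = 0 := by
  have hae := ae_eq_zero_of_integral_sq_eq_zero hφ hC h0
  unfold qform
  refine integral_eq_zero_of_ae (hae.mono fun U hU => ?_)
  simp only [Pi.zero_apply] at hU
  simp [hU]

/-- `l2 φ φ = ∫ φ²`. [folklore] -/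
theorem l2_self_eq_integral_sq {M : ℕ} [NeZero M] (φ : GaugeConfig 3 M SU2 → ℝ) : l2 φ φ = ∫ U, φ U ^ 2 ∂configMeasure SU2 M := by
  unfold l2; exact integral_congr_ae (ae_of_all _ fun U => by simp [sq])

end Summit.QuantumFields.YangMills.Theorems.FemtoTransferGap.TwoLattice.ConstTube

end
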